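import Summits.ValiantsHypothesis.ValiantsHypothesis.Theses.HartogsRankTwo
import Literature.Computability.AlgebraicComplexity.ValiantConjectureEquivProofs

/-!
# Route HartogsRankTwo — `Assembly` (stmt-ValiantsHypothesis-10339)

`HartogsTwo → ValiantsHypothesis`: if `VP ℂ = VNP ℂ` then the permanent family is p-computable
(`perNotPComputableComplex_iff_holds`, von zur Gathen 1987 / Bürgisser 2000), and `per_n` itself is a
polynomial-size polynomial agreeing with `per_n` on rank-`≤ 2` matrices — the witness `HartogsTwo`
excludes. Candidate proof on file since 2026-08-15 (route `closes` body), landed under Theorems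
(prover-only). Honest framing: bookkeeping; nothing here is progress on `VP ≠ VNP`.
-/

set_option linter.dupNamespace false

namespace Summit.ValiantsHypothesis.ValiantsHypothesis.Theorems.HartogsRankTwo

open Literature.Computability.AlgebraicComplexity
open Summit.ValiantsHypothesis.ValiantsHypothesis.Theses.HartogsRankTwo

/-- **Item `Assembly` (stmt-ValiantsHypothesis-10339), PROVED**: `HartogsTwo → VP_ℂ ≠ VNP_ℂ`
(take `P = per_n` itself under `VP = VNP`). [cite: Burgisser2000, Prop. 2.20] -/
theorem assembly_proof : Assembly := by
  intro hH
  show VP ℂ ≠ VNP ℂ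
  rw [← perNotPComputableComplex_iff_holds]
  intro hper
  apply hH
  obtain ⟨c, hc⟩ := hper
  exact ⟨c, fun n => ⟨perPoly (Fin n) ℂ, fun U V => rfl, hc n⟩⟩

end Summit.ValiantsHypothesis.ValiantsHypothesis.Theorems.HartogsRankTwo
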